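import Literature.MathematicalPhysics.QuantumFieldTheory.Balaban1983to89.Node00.OpsYSectDE
import Literature.MathematicalPhysics.QuantumFieldTheory.Balaban1983to89.B9Ineq349SiteComposite

/-!
# `Balaban1983to89.Node00.OpsYGpUnits` — T. Bałaban, *Propagators for lattice gauge theories in a background field*, Commun. Math. Phys. **99**
# (1985) 389–434 [Balaban1985BackgroundPropagators], (3.24)–(3.27) pp. 394–395 and (3.119)–(3.129) pp. 419–421: THE UNITS OF THE SITE PROPAGATOR
# `G′(U)` INSIDE SECT. D — the scaling calculus of NODE 00's letters in `G′`, and the print-units letter `G′_phys(U) = η²·G′_latt(U)`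

statement-level skeleton of published theorems with citation tags; proofs where landed; nothing here is a claim about the Yang–Mills mass gap

THE PRINT.  p. 394–395: *«Δ′_a(U) = Δ_U + Σ_j a_j(L^jη)^{−2} Q′_j(U)*Q′_j(U) (3.24) … Its inverse is denoted by G′, or G′(U)»*; *«R(U) = I −
G′Q′*(Q′G′²Q′*)^{−1}Q′G′ (3.25)»*, *«Δ_a(U) = Δ(U) + D_U R(U) D*_U + Q*(U)aQ(U) (3.26)»*, *«G(U) = Δ_a(U)^{−1} (3.27)»*.  p. 419: *«the expression
A − DG′RD*A has this invariance property … It is obtained by gauge transforming an arbitrary configuration A to the subspace {A : RD*A = 0}»*,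
*«⟨A, Δ_πA⟩ = ⟨A − DG′RD*A, Δ(A − DG′RD*A)⟩ (3.119)»*.  p. 390–392: the covariant derivatives (3.3), (3.8) and the scalar products of the
`η`-lattice carry the lattice spacing `η = L^{−k}` (print's units are the physical ones throughout).

WHY THIS FILE (pub-ymgap bus, dag-n06-l g14 LOCATED-UNITS-D1, 2026-08-27).  NODE 00's operator layer (`Node00.OpsYOfLetters` §2) is typed with the
SITE sector in LATTICE units — `cdS ∕ cdsS ∕ lapS`, `deltaPrimeAY` = [4]'s (2.17) multi-level operator at `η = 1` (`deltaPrimeAY_one = liftOpY mlOpT`),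
`GpY = Ring.inverse deltaPrimeAY` — and the BOND sector in PHYSICAL units `c_f = η⁻¹ = Lᵏ` (`cdB ∕ cdsB`, `gradY ∕ divY ∕ hessY`, r03's `dE c_f`).
The (3.42) reading of `G′` converts by the prefactors `η^(2,1,1,0)` (`kernelFamilyS.e`), the (3.48) letter `CY` by its weight `cWtY ∋ η⁻⁴`.  The
Sect. D COMPOSITES, however — `gaugePiY = 1 − D_U∘G′∘R∘D*_U`, `deltaPiY` (3.119), `deltaPiAY` (3.122), `GDY`, `QGQY`, `QGQinvY`, `HDY` (n06-i's
`B9Eq3132SectDLetters`), `deltaPiPrimeY ∕ delta2PiY ∕ deltaOneY ∕ G1Y ∕ QG1QinvY ∕ H1Y ∕ frakPY ∕ GGY` (`Node00.OpsYSectDE`) — take the site propagator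
as a PARAMETER `Gp` and compose it with the physical-unit `D_U ∕ D*_U ∕ Δ(U)`: they denote print's operators only when fed print's
`G′(U) = (Δ′_{a,phys}(U))⁻¹ = η²·G′_latt(U)`; at `Gp := GpY` the projector term `D_U G′ R D*_U` is `η⁻² = L^{2k}` times print's.  This file supplies
(i) the SCALING CALCULUS of the letters in `Gp`: `(Q′G′²Q′*)` has degree 2, its inverse degree −2, `R(U)` (3.25) degree 0 — hence `Δ_a(U)`, `G(U) =
Δ_a⁻¹` are literally unchanged under `G′ ↦ c·G′`, `c ≠ 0` — the (3.48) letter degree −2, the gauge projections (3.119) affine; (ii) the print-units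
letter `GpPhysY := η² • GpY` with its faces (`= Ring.inverse (η⁻² • Δ′_a)`, the `U = 1` clause `G′_phys(1)(f ⊗ E) = (η²G f) ⊗ E`); (iii) the
TRANSFER: `R ∕ Δ_a ∕ G` at `GpPhysY` equal those at `GpY` (all `U`; `(Q′G′²Q′*)^{∓1} ∕ C` scale by `η^{±4}`), and every Sect. D letter at `U = 1` equals the one at `GpY`
(`Δ_π(1) = Δ(1)` is blind to `G′`, `Node00.OpsYSectDE.deltaPiY_one'`), so every landed `U = 1` face and inhabitant transfers by one rewrite; (iv) the
located display `gaugePiY … GpPhysY … U = 1 − η² • (D_U ∘ GpY ∘ R ∘ D*_U)`.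

HONEST SCOPE.  Definitions and finite-dimensional algebra (scalars through `Ring.inverse` and `∘ₗ`); no inequality of the paper; WHICH site
propagator a certificate pins into the Sect. D letters is the certificate's edition (consumer recipe: the Sect. D pins take `Gp := GpPhysY …`, the
Sect. A–C pins and the (3.42) ∕ (3.48) readings keep `GpY`, whose `η`-prefactors already convert).  Nothing landed is modified; N06 is NOT discharged;
NOT continuum, NOT OS, NOT the mass gap.  Filed by the pub-ymgap def-Y owner lineage (`pub-ymgap-node00-def-Y`, gen 16).  Net new unproved facts: 0.
-/

namespace Literature.MathematicalPhysics.QuantumFieldTheory.Balaban1983to89.Node00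

open B6KLevelCensusIndexV1 (KIdx)
open B9Ineq349SiteComposite (etaS_pos)
open B9Eq3132SectDLetters (gaugePiY gaugePiTY deltaPiY deltaPiAY GDY QGQY QGQinvY HDY)
open scoped Matrix

noncomputable section

variable {d ℓ : ℕ} {hd : 1 ≤ d + 1} {hL : Odd (ℓ + 1) ∧ 1 < ℓ + 1} {b₀ b₁ : ℝ}
variable {𝔸 : Type} [NormedRing 𝔸] [NormedAlgebra ℂ 𝔸] [CompleteSpace 𝔸]

/-! ## §0 `Ring.inverse` through a nonzero scalar -/

section RingInverseSmul

variable {𝕜 R : Type} [Field 𝕜] [Ring R] [Algebra 𝕜 R]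

/-- a unit stays a unit under a nonzero scalar. [cite: Balaban1985BackgroundPropagators, (3.25) p.394, bookkeeping] -/
theorem isUnit_smul_of_isUnit {c : 𝕜} (hc : c ≠ 0) {T : R} (hT : IsUnit T) : IsUnit (c • T) := by
  obtain ⟨u, rfl⟩ := hT
  refine ⟨⟨c • (u : R), c⁻¹ • (↑u⁻¹ : R), ?_, ?_⟩, rfl⟩
  · rw [smul_mul_smul_comm, mul_inv_cancel₀ hc, one_smul, Units.mul_inv]
  · rw [smul_mul_smul_comm, inv_mul_cancel₀ hc, one_smul, Units.inv_mul]

/-- `IsUnit (c • T) ↔ IsUnit T` for `c ≠ 0`. [cite: Balaban1985BackgroundPropagators, (3.25) p.394, bookkeeping] -/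
theorem isUnit_smul_iff_of_ne_zero {c : 𝕜} (hc : c ≠ 0) (T : R) : IsUnit (c • T) ↔ IsUnit T := by
  refine ⟨fun h => ?_, isUnit_smul_of_isUnit hc⟩
  have h' := isUnit_smul_of_isUnit (inv_ne_zero hc) h
  rwa [smul_smul, inv_mul_cancel₀ hc, one_smul] at h'

/-- **`(c·T)⁻¹ = c⁻¹·T⁻¹` in `Ring.inverse` form** (both sides `0` off units) — the one line behind every degree count below.
[cite: Balaban1985BackgroundPropagators, (3.25) p.394, bookkeeping] -/
theorem ringInverse_smul_of_ne_zero {c : 𝕜} (hc : c ≠ 0) (T : R) : Ring.inverse (c • T) = c⁻¹ • Ring.inverse T := by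
  by_cases hT : IsUnit T
  · have h1 : c • T * (c⁻¹ • Ring.inverse T) = 1 := by
      rw [smul_mul_smul_comm, mul_inv_cancel₀ hc, one_smul, Ring.mul_inverse_cancel _ hT]
    have h2 : c⁻¹ • Ring.inverse T * (c • T) = 1 := by
      rw [smul_mul_smul_comm, inv_mul_cancel₀ hc, one_smul, Ring.inverse_mul_cancel _ hT]
    let u : Rˣ := ⟨c • T, c⁻¹ • Ring.inverse T, h1, h2⟩
    show Ring.inverse (u : R) = _
    rw [Ring.inverse_unit]
    rfl
  · rw [Ring.inverse_non_unit _ hT, Ring.inverse_non_unit _ ((isUnit_smul_iff_of_ne_zero hc T).not.mpr hT), smul_zero]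

/-- `(c·T)⁻¹ = c⁻¹·T⁻¹` in `Ring.inverse` form, for `ℂ`-linear endomorphisms (the instance the letters elaborate to).
[cite: Balaban1985BackgroundPropagators, (3.25) p.394, bookkeeping] -/
theorem ringInverse_smul_linearMap {V : Type} [AddCommGroup V] [Module ℂ V] {c : ℂ} (hc : c ≠ 0) (T : V →ₗ[ℂ] V) :
    Ring.inverse (c • T) = c⁻¹ • Ring.inverse T :=
  ringInverse_smul_of_ne_zero hc T

end RingInverseSmul

/-! ## §1 The scaling calculus of the letters in the site propagator `G′ ↦ c·G′` -/

section Scaling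

variable (i : KIdx d ℓ hd hL b₀ b₁)
variable {parS : SiteParY 𝔸 i} {parB : BondParY 𝔸 i} {Gp : SiteOpY 𝔸 i} {c : ℂ}

/-- `(Q′G′²Q′*)(U)` has degree 2 in `G′`. [cite: Balaban1985BackgroundPropagators, (3.25) p.394, bookkeeping] -/
theorem XY_smul_Gp (parS : SiteParY 𝔸 i) (Gp : SiteOpY 𝔸 i) (c : ℂ) (U : CfgY 𝔸 i) :
    XY i parS (c • Gp) U = c ^ 2 • XY i parS Gp U := by
  simp only [XY, Pi.smul_apply, LinearMap.smul_comp, LinearMap.comp_smul, smul_smul, pow_two]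

/-- `(Q′G′²Q′*)⁻¹(U)` has degree −2 in `G′` (`c ≠ 0`). [cite: Balaban1985BackgroundPropagators, (3.25) p.394, bookkeeping] -/
theorem XinvY_smul_Gp (parS : SiteParY 𝔸 i) (Gp : SiteOpY 𝔸 i) (hc : c ≠ 0) (U : CfgY 𝔸 i) :
    XinvY i parS (c • Gp) U = (c ^ 2)⁻¹ • XinvY i parS Gp U := by
  rw [XinvY, XinvY, XY_smul_Gp, ringInverse_smul_linearMap (pow_ne_zero 2 hc)]

/-- ★ **`R(U)` (3.25) IS HOMOGENEOUS OF DEGREE 0 IN `G′`**: `R[c·G′] = R[G′]` for `c ≠ 0` — the projection does not see the units of the site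
propagator. [cite: Balaban1985BackgroundPropagators, (3.25) p.394] -/
theorem RY_smul_Gp (parS : SiteParY 𝔸 i) (Gp : SiteOpY 𝔸 i) (hc : c ≠ 0) (U : CfgY 𝔸 i) :
    RY i parS (c • Gp) U = RY i parS Gp U := by
  have hk : c * (c ^ 2)⁻¹ * c = 1 := by field_simp
  rw [RY, RY, Pi.smul_apply, XinvY_smul_Gp i parS Gp hc]
  simp only [LinearMap.smul_comp, LinearMap.comp_smul, smul_smul, hk, one_smul]

/-- `R` at the rescaled letter, as a letter. [cite: Balaban1985BackgroundPropagators, (3.25) p.394, bookkeeping] -/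
theorem RY_smul_Gp' (parS : SiteParY 𝔸 i) (Gp : SiteOpY 𝔸 i) (hc : c ≠ 0) : RY i parS (c • Gp) = RY i parS Gp :=
  funext fun U => RY_smul_Gp i parS Gp hc U

/-- ★ **`Δ_a(U)` (3.26) DOES NOT SEE THE UNITS OF `G′`**: it involves `G′` only through `R(U)`. [cite: Balaban1985BackgroundPropagators, (3.26) p.395] -/
theorem deltaAY_smul_Gp (parS : SiteParY 𝔸 i) (parB : BondParY 𝔸 i) (Gp : SiteOpY 𝔸 i) (hc : c ≠ 0) (U : CfgY 𝔸 i) :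
    deltaAY i parS parB (c • Gp) U = deltaAY i parS parB Gp U := by
  rw [deltaAY, deltaAY, RY_smul_Gp i parS Gp hc]

/-- ★ **`G(U) = Δ_a(U)⁻¹` (3.27) DOES NOT SEE THE UNITS OF `G′`**, as a letter. [cite: Balaban1985BackgroundPropagators, (3.27) p.395] -/
theorem GAY_smul_Gp (parS : SiteParY 𝔸 i) (parB : BondParY 𝔸 i) (Gp : SiteOpY 𝔸 i) (hc : c ≠ 0) :
    GAY i parS parB (c • Gp) = GAY i parS parB Gp := by
  funext U
  show Ring.inverse _ = Ring.inverse _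
  rw [deltaAY_smul_Gp i parS parB Gp hc]

/-- the (3.48) letter has degree −2 in `G′` (its reading weight `cWtY ∋ η⁻⁴` is calibrated to the LATTICE `G′ = GpY`).
[cite: Balaban1985BackgroundPropagators, (3.48) p.398, (3.25) p.394, bookkeeping] -/
theorem CY_smul_Gp (parS : SiteParY 𝔸 i) (Gp : SiteOpY 𝔸 i) (hc : c ≠ 0) (U : CfgY 𝔸 i) :
    CY i parS (c • Gp) U = (c ^ 2)⁻¹ • CY i parS Gp U := by
  rw [CY, CY, XinvY_smul_Gp i parS Gp hc, LinearMap.smul_comp]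

/-- **the gauge projection `1 − D_U G′ R D*_U` of (3.119) is AFFINE in `G′`**: `π[c·G′] = 1 − c·(D_U ∘ G′ ∘ R ∘ D*_U)` (`R` unchanged) — the term
that carries the units of the site propagator. [cite: Balaban1985BackgroundPropagators, (3.119) p.419] -/
theorem gaugePiY_smul_Gp (parS : SiteParY 𝔸 i) (Gp : SiteOpY 𝔸 i) (hc : c ≠ 0) (U : CfgY 𝔸 i) :
    gaugePiY i parS (c • Gp) U = LinearMap.id - c • (gradY i U ∘ₗ Gp U ∘ₗ RY i parS Gp U ∘ₗ divY i U) := by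
  rw [gaugePiY, RY_smul_Gp i parS Gp hc, Pi.smul_apply, LinearMap.smul_comp, LinearMap.comp_smul]

/-- the adjoint gauge projection `1 − D_U R G′ D*_U` is affine in `G′` likewise. [cite: Balaban1985BackgroundPropagators, (3.119) p.419] -/
theorem gaugePiTY_smul_Gp (parS : SiteParY 𝔸 i) (Gp : SiteOpY 𝔸 i) (hc : c ≠ 0) (U : CfgY 𝔸 i) :
    gaugePiTY i parS (c • Gp) U = LinearMap.id - c • (gradY i U ∘ₗ RY i parS Gp U ∘ₗ Gp U ∘ₗ divY i U) := by
  rw [gaugePiTY, RY_smul_Gp i parS Gp hc, Pi.smul_apply, LinearMap.smul_comp, LinearMap.comp_smul, LinearMap.comp_smul]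

/-! ### Sect. D's letters at `U = 1` do not see the units of `G′` either (`Δ_π(1) = Δ(1)` is blind to `G′`) -/

/-- Sect. D's `G(1)` at the rescaled letter. [cite: Balaban1985BackgroundPropagators, (3.122) p.420, Cor. 3.5 p.407, bookkeeping] -/
theorem GDY_smul_Gp_one (parS : SiteParY 𝔸 i) (parB : BondParY 𝔸 i) (Gp : SiteOpY 𝔸 i) (hc : c ≠ 0) :
    GDY i parS parB (c • Gp) (fun _ _ => 1) = GDY i parS parB Gp (fun _ _ => 1) := by
  rw [GDY_one', GDY_one', GAY_smul_Gp i parS parB Gp hc]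

/-- `(QGQ*)(1)` at the rescaled letter. [cite: Balaban1985BackgroundPropagators, (3.123) p.420, Cor. 3.5 p.407, bookkeeping] -/
theorem QGQY_smul_Gp_one (parS : SiteParY 𝔸 i) (parB : BondParY 𝔸 i) (Gp : SiteOpY 𝔸 i) (hc : c ≠ 0) :
    QGQY i parS parB (c • Gp) (fun _ _ => 1) = QGQY i parS parB Gp (fun _ _ => 1) := by
  rw [QGQY, QGQY, GDY_smul_Gp_one i parS parB Gp hc]

/-- `(QGQ*)⁻¹(1)` at the rescaled letter. [cite: Balaban1985BackgroundPropagators, (3.132) p.422, Cor. 3.5 p.407, bookkeeping] -/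
theorem QGQinvY_smul_Gp_one (parS : SiteParY 𝔸 i) (parB : BondParY 𝔸 i) (Gp : SiteOpY 𝔸 i) (hc : c ≠ 0) :
    QGQinvY i parS parB (c • Gp) (fun _ _ => 1) = QGQinvY i parS parB Gp (fun _ _ => 1) := by
  show Ring.inverse _ = Ring.inverse _
  rw [QGQY_smul_Gp_one i parS parB Gp hc]

/-- `H(1)` (3.126) at the rescaled letter. [cite: Balaban1985BackgroundPropagators, (3.126) p.420, Cor. 3.5 p.407, bookkeeping] -/
theorem HDY_smul_Gp_one (parS : SiteParY 𝔸 i) (parB : BondParY 𝔸 i) (Gp : SiteOpY 𝔸 i) (hc : c ≠ 0) :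
    HDY i parS parB (c • Gp) (fun _ _ => 1) = HDY i parS parB Gp (fun _ _ => 1) := by
  rw [HDY, HDY, GDY_smul_Gp_one i parS parB Gp hc, QGQinvY_smul_Gp_one i parS parB Gp hc]

/-- `G₁(1)` at the rescaled letter, for residual letters vanishing at `1`. [cite: Balaban1985BackgroundPropagators, (3.128) p.421, Cor. 3.5 p.407, bookkeeping] -/
theorem G1Y_smul_Gp_one (parS : SiteParY 𝔸 i) (parB : BondParY 𝔸 i) (Gp : SiteOpY 𝔸 i) (hc : c ≠ 0) {Δ2 Δ2' : BondOpY 𝔸 i}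
    (hΔ : Δ2 (fun _ _ => 1) = 0) (hΔ' : Δ2' (fun _ _ => 1) = 0) :
    G1Y i parS parB (c • Gp) Δ2 (fun _ _ => 1) = G1Y i parS parB Gp Δ2' (fun _ _ => 1) := by
  rw [G1Y_one i parS parB _ hΔ, G1Y_one i parS parB _ hΔ', GAY_smul_Gp i parS parB Gp hc]

/-- `(QG₁Q*)⁻¹(1)` at the rescaled letter. [cite: Balaban1985BackgroundPropagators, (3.132) p.422, Cor. 3.5 p.407, bookkeeping] -/
theorem QG1QinvY_smul_Gp_one (parS : SiteParY 𝔸 i) (parB : BondParY 𝔸 i) (Gp : SiteOpY 𝔸 i) (hc : c ≠ 0) {Δ2 Δ2' : BondOpY 𝔸 i}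
    (hΔ : Δ2 (fun _ _ => 1) = 0) (hΔ' : Δ2' (fun _ _ => 1) = 0) :
    QG1QinvY i parS parB (c • Gp) Δ2 (fun _ _ => 1) = QG1QinvY i parS parB Gp Δ2' (fun _ _ => 1) := by
  rw [QG1QinvY_one i parS parB _ hΔ, QG1QinvY_one i parS parB _ hΔ', QGQinvY_smul_Gp_one i parS parB Gp hc]

/-- `H₁(1)` at the rescaled letter. [cite: Balaban1985BackgroundPropagators, (3.129) p.421, Cor. 3.5 p.407, bookkeeping] -/
theorem H1Y_smul_Gp_one (parS : SiteParY 𝔸 i) (parB : BondParY 𝔸 i) (Gp : SiteOpY 𝔸 i) (hc : c ≠ 0) {Δ2 Δ2' : BondOpY 𝔸 i}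
    (hΔ : Δ2 (fun _ _ => 1) = 0) (hΔ' : Δ2' (fun _ _ => 1) = 0) :
    H1Y i parS parB (c • Gp) Δ2 (fun _ _ => 1) = H1Y i parS parB Gp Δ2' (fun _ _ => 1) := by
  rw [H1Y_one i parS parB _ hΔ, H1Y_one i parS parB _ hΔ', HDY_smul_Gp_one i parS parB Gp hc]

/-- `𝔓*(1)` (3.147) at the rescaled letter. [cite: Balaban1985BackgroundPropagators, (3.147) p.425, Cor. 3.5 p.407, bookkeeping] -/
theorem frakPY_smul_Gp_one (parS : SiteParY 𝔸 i) (parB : BondParY 𝔸 i) (Gp : SiteOpY 𝔸 i) (hc : c ≠ 0) {Δ2 Δ2' : BondOpY 𝔸 i}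
    (hΔ : Δ2 (fun _ _ => 1) = 0) (hΔ' : Δ2' (fun _ _ => 1) = 0) :
    frakPY i parS parB (c • Gp) Δ2 (fun _ _ => 1) = frakPY i parS parB Gp Δ2' (fun _ _ => 1) := by
  rw [frakPY, frakPY, G1Y_smul_Gp_one i parS parB Gp hc hΔ hΔ', QG1QinvY_smul_Gp_one i parS parB Gp hc hΔ hΔ', RY_smul_Gp i parS Gp hc]

/-- `𝔊(1)` (3.153) at the rescaled letter. [cite: Balaban1985BackgroundPropagators, (3.153) p.426, Cor. 3.5 p.407, bookkeeping] -/
theorem GGY_smul_Gp_one (parS : SiteParY 𝔸 i) (parB : BondParY 𝔸 i) (Gp : SiteOpY 𝔸 i) (hc : c ≠ 0) {Δ2 Δ2' : BondOpY 𝔸 i}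
    (hΔ : Δ2 (fun _ _ => 1) = 0) (hΔ' : Δ2' (fun _ _ => 1) = 0) :
    GGY i parS parB (c • Gp) Δ2 (fun _ _ => 1) = GGY i parS parB Gp Δ2' (fun _ _ => 1) := by
  show frakPY i parS parB (c • Gp) Δ2 (fun _ _ => 1) ∘ₗ G1Y i parS parB (c • Gp) Δ2 (fun _ _ => 1) = _
  rw [frakPY_smul_Gp_one i parS parB Gp hc hΔ hΔ', G1Y_smul_Gp_one i parS parB Gp hc hΔ hΔ']
  rfl

end Scaling

/-! ## §2 The print-units site propagator `G′_phys(U) = η²·G′_latt(U)` -/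

section Phys

variable (i : KIdx d ℓ hd hL b₀ b₁)

/-- the complex scalar `η²` is nonzero. [cite: Balaban1985BackgroundPropagators, (3.1) p.390, bookkeeping] -/
theorem etaS_sq_coe_ne_zero : (((etaS i) ^ 2 : ℝ) : ℂ) ≠ 0 :=
  Complex.ofReal_ne_zero.2 (pow_ne_zero 2 (etaS_pos i).ne')

/-- ★★ **THE PRINT-UNITS SITE PROPAGATOR `G′_phys(U) := η² · G′_latt(U)`** — print's `G′(U) = (Δ′_a(U))⁻¹` of (3.24)–(3.25) in the PHYSICAL units of
the `η`-lattice (`Δ′_{a,phys} = η⁻²·Δ′_{a,latt}`), the letter to feed the Sect. D composites (3.119)–(3.153) built over the physical-unit `D_U ∕ D*_U ∕ Δ(U)`.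
[cite: Balaban1985BackgroundPropagators, (3.24)–(3.25) pp.394–395, (3.119) p.419] -/
def GpPhysY (par : SiteParY 𝔸 i) : SiteOpY 𝔸 i := (((etaS i) ^ 2 : ℝ) : ℂ) • GpY i par

/-- `G′_phys(U)`, evaluated. [cite: Balaban1985BackgroundPropagators, (3.25) p.394, bookkeeping] -/
theorem GpPhysY_apply (par : SiteParY 𝔸 i) (U : CfgY 𝔸 i) : GpPhysY i par U = (((etaS i) ^ 2 : ℝ) : ℂ) • GpY i par U := rfl

/-- ★ **`G′_phys = (η⁻²·Δ′_a)⁻¹`**: the print-units letter is the inverse (`Ring.inverse`) of the lattice operator (3.24) rescaled to physical units.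
[cite: Balaban1985BackgroundPropagators, (3.24)–(3.25) pp.394–395] -/
theorem GpPhysY_eq_ringInverse (par : SiteParY 𝔸 i) (U : CfgY 𝔸 i) :
    GpPhysY i par U = Ring.inverse (((((etaS i) ^ 2)⁻¹ : ℝ) : ℂ) • deltaPrimeAY i par U) := by
  rw [Complex.ofReal_inv, ringInverse_smul_linearMap (inv_ne_zero (etaS_sq_coe_ne_zero i)), inv_inv]
  rfl

/-- `(η⁻²Δ′_a(U))·G′_phys(U) = 1` wherever `Δ′_a(U)` is invertible. [cite: Balaban1985BackgroundPropagators, p.395, bookkeeping] -/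
theorem deltaPrimeAPhys_mul_GpPhysY (par : SiteParY 𝔸 i) (U : CfgY 𝔸 i) (hU : IsUnit (deltaPrimeAY i par U)) :
    (((((etaS i) ^ 2)⁻¹ : ℝ) : ℂ) • deltaPrimeAY i par U) * GpPhysY i par U = 1 := by
  rw [GpPhysY_apply, smul_mul_smul_comm, Complex.ofReal_inv, inv_mul_cancel₀ (etaS_sq_coe_ne_zero i), one_smul, deltaPrimeAY_mul_GpY i par U hU]

/-- `G′_phys(U)·(η⁻²Δ′_a(U)) = 1` wherever `Δ′_a(U)` is invertible. [cite: Balaban1985BackgroundPropagators, p.395, bookkeeping] -/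
theorem GpPhysY_mul_deltaPrimeAPhys (par : SiteParY 𝔸 i) (U : CfgY 𝔸 i) (hU : IsUnit (deltaPrimeAY i par U)) :
    GpPhysY i par U * (((((etaS i) ^ 2)⁻¹ : ℝ) : ℂ) • deltaPrimeAY i par U) = 1 := by
  rw [GpPhysY_apply, smul_mul_smul_comm, Complex.ofReal_inv, mul_inv_cancel₀ (etaS_sq_coe_ne_zero i), one_smul, GpY_mul_deltaPrimeAY i par U hU]

omit [CompleteSpace 𝔸] in
/-- a real scalar passes through the product-form lift `f ⊗ E`. [folklore] -/
private theorem liftY_real_smul {X : Type} (r : ℝ) (f : X → ℝ) (E : 𝔸) : liftY (r • f) E = ((r : ℝ) : ℂ) • liftY f E := by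
  funext z
  simp only [liftY_apply, Pi.smul_apply, smul_eq_mul, Complex.ofReal_mul, mul_smul]

/-- ★ **THE `U = 1` CLAUSE OF `G′_phys`**: `G′_phys(1) = η²·G♯`, the lift of NODE 00's `(Δ′_a)⁻¹ = KTIdx.G` of [4] (2.19) rescaled to physical units.
[cite: Balaban1985BackgroundPropagators, Cor. 3.5 p.407, p.395; Balaban1984PropagatorsII, p.225] -/
theorem GpPhysY_one (par : SiteParY 𝔸 i) (hpar : ∀ z w, par (fun _ _ => 1) z w = 1) :
    GpPhysY i par (fun _ _ => 1) = (((etaS i) ^ 2 : ℝ) : ℂ) • liftOpY 𝔸 (toKT i).G := by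
  rw [GpPhysY_apply, GpY_one i par hpar]

/-- the `U = 1` clause on product-form arguments: `G′_phys(1)(f ⊗ E) = ((η²G) f) ⊗ E`. [cite: Balaban1985BackgroundPropagators, Cor. 3.5 p.407; Balaban1984PropagatorsII, Prop. 2.2 p.234] -/
theorem GpPhysY_one_liftY (par : SiteParY 𝔸 i) (hpar : ∀ z w, par (fun _ _ => 1) z w = 1) (f : SiteY i → ℝ) (E : 𝔸) :
    GpPhysY i par (fun _ _ => 1) (liftY f E) = liftY (((etaS i) ^ 2 • (toKT i).G) *ᵥ f) E := by
  rw [GpPhysY_apply, LinearMap.smul_apply, GpY_one_liftY i par hpar, Matrix.smul_mulVec, liftY_real_smul]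

/-! ### Transfer: Sect. A–C letters at `G′_phys` equal those at `G′_latt` (all `U`); Sect. D letters at `U = 1` likewise -/

variable {i}

/-- ★★ **`R(U)` AT THE PRINT-UNITS LETTER IS `R(U)` AT THE LATTICE LETTER** (degree 0). [cite: Balaban1985BackgroundPropagators, (3.25) p.394] -/
theorem RY_GpPhysY (parS : SiteParY 𝔸 i) : RY i parS (GpPhysY i parS) = RY i parS (GpY i parS) :=
  RY_smul_Gp' i parS (GpY i parS) (etaS_sq_coe_ne_zero i)

/-- ★★ **`Δ_a(U)` AT THE PRINT-UNITS LETTER IS `Δ_a(U)` AT THE LATTICE LETTER** — the Sect. A–C pins are unchanged by the re-base.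
[cite: Balaban1985BackgroundPropagators, (3.26) p.395] -/
theorem deltaAY_GpPhysY (parS : SiteParY 𝔸 i) (parB : BondParY 𝔸 i) (U : CfgY 𝔸 i) :
    deltaAY i parS parB (GpPhysY i parS) U = deltaAY i parS parB (GpY i parS) U :=
  deltaAY_smul_Gp i parS parB (GpY i parS) (etaS_sq_coe_ne_zero i) U

/-- ★★ **`G(U) = Δ_a⁻¹` AT THE PRINT-UNITS LETTER IS THE ONE AT THE LATTICE LETTER.** [cite: Balaban1985BackgroundPropagators, (3.27) p.395] -/
theorem GAY_GpPhysY (parS : SiteParY 𝔸 i) (parB : BondParY 𝔸 i) : GAY i parS parB (GpPhysY i parS) = GAY i parS parB (GpY i parS) :=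
  GAY_smul_Gp i parS parB (GpY i parS) (etaS_sq_coe_ne_zero i)

/-- the (3.48) letter at the print-units letter is `η⁻⁴` times the one at the lattice letter — the readings (3.42) ∕ (3.48) KEEP `GpY` (their weights
already carry the `η`-powers; re-basing them would double-count). [cite: Balaban1985BackgroundPropagators, (3.48) p.398, bookkeeping] -/
theorem CY_GpPhysY (parS : SiteParY 𝔸 i) (U : CfgY 𝔸 i) :
    CY i parS (GpPhysY i parS) U = ((((etaS i) ^ 2 : ℝ) : ℂ) ^ 2)⁻¹ • CY i parS (GpY i parS) U :=
  CY_smul_Gp i parS (GpY i parS) (etaS_sq_coe_ne_zero i) U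

/-- ★★ **THE LOCATED DISPLAY**: the gauge projection (3.119) at the print-units letter is `1 − η²·(D_U ∘ G′_latt ∘ R ∘ D*_U)` — the projector term at the
LATTICE letter is `η⁻² = L^{2k}` times print's. [cite: Balaban1985BackgroundPropagators, (3.119) p.419] -/
theorem gaugePiY_GpPhysY (parS : SiteParY 𝔸 i) (U : CfgY 𝔸 i) :
    gaugePiY i parS (GpPhysY i parS) U =
      LinearMap.id - (((etaS i) ^ 2 : ℝ) : ℂ) • (gradY i U ∘ₗ GpY i parS U ∘ₗ RY i parS (GpY i parS) U ∘ₗ divY i U) :=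
  gaugePiY_smul_Gp i parS (GpY i parS) (etaS_sq_coe_ne_zero i) U

/-- the adjoint gauge projection at the print-units letter. [cite: Balaban1985BackgroundPropagators, (3.119) p.419] -/
theorem gaugePiTY_GpPhysY (parS : SiteParY 𝔸 i) (U : CfgY 𝔸 i) :
    gaugePiTY i parS (GpPhysY i parS) U =
      LinearMap.id - (((etaS i) ^ 2 : ℝ) : ℂ) • (gradY i U ∘ₗ RY i parS (GpY i parS) U ∘ₗ GpY i parS U ∘ₗ divY i U) :=
  gaugePiTY_smul_Gp i parS (GpY i parS) (etaS_sq_coe_ne_zero i) U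

/-- ★ Sect. D's `G(1)` at the print-units letter is the one at the lattice letter (so n06-i's `GDY_one ∕ GDY_one_liftEndY ∕ GDY_one_liftY` transfer).
[cite: Balaban1985BackgroundPropagators, (3.122) p.420, Cor. 3.5 p.407] -/
theorem GDY_GpPhysY_one (parS : SiteParY 𝔸 i) (parB : BondParY 𝔸 i) :
    GDY i parS parB (GpPhysY i parS) (fun _ _ => 1) = GDY i parS parB (GpY i parS) (fun _ _ => 1) :=
  GDY_smul_Gp_one i parS parB (GpY i parS) (etaS_sq_coe_ne_zero i)

/-- `(QGQ*)(1)` at the print-units letter (so `QGQY_one ∕ QGQY_one_liftEndY ∕ isUnit_QGQY_one` transfer). [cite: Balaban1985BackgroundPropagators, (3.123) p.420, Cor. 3.5 p.407] -/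
theorem QGQY_GpPhysY_one (parS : SiteParY 𝔸 i) (parB : BondParY 𝔸 i) :
    QGQY i parS parB (GpPhysY i parS) (fun _ _ => 1) = QGQY i parS parB (GpY i parS) (fun _ _ => 1) :=
  QGQY_smul_Gp_one i parS parB (GpY i parS) (etaS_sq_coe_ne_zero i)

/-- ★ `(QGQ*)⁻¹(1)` at the print-units letter (so `QGQinvY_one_liftEndY ∕ QGQinvY_one_liftY` and row 26's `U = 1` inhabitants transfer).
[cite: Balaban1985BackgroundPropagators, (3.132) p.422, Cor. 3.5 p.407] -/
theorem QGQinvY_GpPhysY_one (parS : SiteParY 𝔸 i) (parB : BondParY 𝔸 i) :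
    QGQinvY i parS parB (GpPhysY i parS) (fun _ _ => 1) = QGQinvY i parS parB (GpY i parS) (fun _ _ => 1) :=
  QGQinvY_smul_Gp_one i parS parB (GpY i parS) (etaS_sq_coe_ne_zero i)

/-- ★ `H(1)` (3.126) at the print-units letter. [cite: Balaban1985BackgroundPropagators, (3.126) p.420, Cor. 3.5 p.407] -/
theorem HDY_GpPhysY_one (parS : SiteParY 𝔸 i) (parB : BondParY 𝔸 i) :
    HDY i parS parB (GpPhysY i parS) (fun _ _ => 1) = HDY i parS parB (GpY i parS) (fun _ _ => 1) :=
  HDY_smul_Gp_one i parS parB (GpY i parS) (etaS_sq_coe_ne_zero i)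

/-- ★ `G₁(1)` at the print-units letter, for residual letters vanishing at `1` (the residual letter may itself be re-based: two residuals `Δ2, Δ2′`).
[cite: Balaban1985BackgroundPropagators, (3.128) p.421, Cor. 3.5 p.407] -/
theorem G1Y_GpPhysY_one (parS : SiteParY 𝔸 i) (parB : BondParY 𝔸 i) {Δ2 Δ2' : BondOpY 𝔸 i} (hΔ : Δ2 (fun _ _ => 1) = 0)
    (hΔ' : Δ2' (fun _ _ => 1) = 0) :
    G1Y i parS parB (GpPhysY i parS) Δ2 (fun _ _ => 1) = G1Y i parS parB (GpY i parS) Δ2' (fun _ _ => 1) :=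
  G1Y_smul_Gp_one i parS parB (GpY i parS) (etaS_sq_coe_ne_zero i) hΔ hΔ'

/-- `(QG₁Q*)⁻¹(1)` at the print-units letter. [cite: Balaban1985BackgroundPropagators, (3.132) p.422, Cor. 3.5 p.407] -/
theorem QG1QinvY_GpPhysY_one (parS : SiteParY 𝔸 i) (parB : BondParY 𝔸 i) {Δ2 Δ2' : BondOpY 𝔸 i} (hΔ : Δ2 (fun _ _ => 1) = 0)
    (hΔ' : Δ2' (fun _ _ => 1) = 0) :
    QG1QinvY i parS parB (GpPhysY i parS) Δ2 (fun _ _ => 1) = QG1QinvY i parS parB (GpY i parS) Δ2' (fun _ _ => 1) :=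
  QG1QinvY_smul_Gp_one i parS parB (GpY i parS) (etaS_sq_coe_ne_zero i) hΔ hΔ'

/-- `H₁(1)` (3.129) at the print-units letter. [cite: Balaban1985BackgroundPropagators, (3.129) p.421, Cor. 3.5 p.407] -/
theorem H1Y_GpPhysY_one (parS : SiteParY 𝔸 i) (parB : BondParY 𝔸 i) {Δ2 Δ2' : BondOpY 𝔸 i} (hΔ : Δ2 (fun _ _ => 1) = 0)
    (hΔ' : Δ2' (fun _ _ => 1) = 0) :
    H1Y i parS parB (GpPhysY i parS) Δ2 (fun _ _ => 1) = H1Y i parS parB (GpY i parS) Δ2' (fun _ _ => 1) :=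
  H1Y_smul_Gp_one i parS parB (GpY i parS) (etaS_sq_coe_ne_zero i) hΔ hΔ'

/-- `𝔊(1)` (3.153) at the print-units letter. [cite: Balaban1985BackgroundPropagators, (3.153) p.426, Cor. 3.5 p.407] -/
theorem GGY_GpPhysY_one (parS : SiteParY 𝔸 i) (parB : BondParY 𝔸 i) {Δ2 Δ2' : BondOpY 𝔸 i} (hΔ : Δ2 (fun _ _ => 1) = 0)
    (hΔ' : Δ2' (fun _ _ => 1) = 0) :
    GGY i parS parB (GpPhysY i parS) Δ2 (fun _ _ => 1) = GGY i parS parB (GpY i parS) Δ2' (fun _ _ => 1) :=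
  GGY_smul_Gp_one i parS parB (GpY i parS) (etaS_sq_coe_ne_zero i) hΔ hΔ'

/-! ### Gauge covariance (3.33) and invertibility transfer -/

/-- a scalar multiple of a covariant site letter is covariant. [cite: Balaban1985BackgroundPropagators, (3.33) p.396, bookkeeping] -/
theorem isCovSiteOpY_smul {Gp : SiteOpY 𝔸 i} (c : ℂ) (h : IsCovSiteOpY i Gp) : IsCovSiteOpY i (c • Gp) := fun g U => (h g U).smul c

/-- ★ **(3.33) FOR THE PRINT-UNITS LETTER**: `G′_phys(U^u) R(u) = R(u) G′_phys(U)` (for a lawful site transporter).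
[cite: Balaban1985BackgroundPropagators, (3.33) p.396 («G′(U^u) = R(u)G′(U)R(u⁻¹)»)] -/
theorem GpPhysY_isCovSiteOpY {parS : SiteParY 𝔸 i} (hS : IsGaugeLawS i parS) : IsCovSiteOpY i (GpPhysY i parS) :=
  isCovSiteOpY_smul _ (GpY_isCovSiteOpY hS)

/-- `(Q′G′²Q′*)(U)` is invertible at the rescaled letter iff at the letter (`c ≠ 0`). [cite: Balaban1985BackgroundPropagators, Thm 3.2 p.398, bookkeeping] -/
theorem isUnit_XY_smul_Gp_iff (parS : SiteParY 𝔸 i) (Gp : SiteOpY 𝔸 i) {c : ℂ} (hc : c ≠ 0) (U : CfgY 𝔸 i) :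
    IsUnit (XY i parS (c • Gp) U) ↔ IsUnit (XY i parS Gp U) := by
  rw [XY_smul_Gp]
  exact isUnit_smul_iff_of_ne_zero (pow_ne_zero 2 hc) _

/-- `(Q′G′²Q′*)(U)` is invertible at the print-units letter iff at the lattice letter — Thm 3.2's regime is the same.
[cite: Balaban1985BackgroundPropagators, Thm 3.2 p.398, bookkeeping] -/
theorem isUnit_XY_GpPhysY_iff (parS : SiteParY 𝔸 i) (U : CfgY 𝔸 i) :
    IsUnit (XY i parS (GpPhysY i parS) U) ↔ IsUnit (XY i parS (GpY i parS) U) :=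
  isUnit_XY_smul_Gp_iff parS (GpY i parS) (etaS_sq_coe_ne_zero i) U

/-- `Δ_a(U)` is invertible at the print-units letter iff at the lattice letter (it is the same operator) — Thm 3.3's regime is the same.
[cite: Balaban1985BackgroundPropagators, Thm 3.3 p.399, bookkeeping] -/
theorem isUnit_deltaAY_GpPhysY_iff (parS : SiteParY 𝔸 i) (parB : BondParY 𝔸 i) (U : CfgY 𝔸 i) :
    IsUnit (deltaAY i parS parB (GpPhysY i parS) U) ↔ IsUnit (deltaAY i parS parB (GpY i parS) U) := by
  rw [deltaAY_GpPhysY]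

end Phys

end

end Literature.MathematicalPhysics.QuantumFieldTheory.Balaban1983to89.Node00
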